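import Summits.QuantumFields.YangMills.Theorems.ToronSmallBallOwnAxisShiftCost
import Summits.QuantumFields.YangMills.Theorems.ToronSmallBallOwnAxisShiftGood
import Summits.QuantumFields.YangMills.Theorems.LuscherReductionRunningReductionTraceFormulaAveraging
import HarnessLib

/-!
# The own-axis sheet shift in the seam sectors without `x`-twist: commutation with `twist3 z` (`z 0 = false`), cost and floors

Support module (`--supports` stmt-QuantumFields-24092, `QuantileBitPurity.HolonomyLevyWindowDeepR`; seat ym-dw-p1 g15).  The own-axis sheet shift
(`Theorems/ToronSmallBallOwnAxisShift*`, which proved ⟨24089⟩ in the periodic sector) works verbatim in the four seam sectors `z` with `z 0 = false`: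
the composite centre twist `twist3 z` then only multiplies `y`- and `z`-links, so

* §1 `lineHolonomy_twist3_of_apply_zero` / `ownShift_twist3_comm`: the `x`-line holonomies and the own-axis field are unchanged by `twist3 z`, and
  `ownShift θ (twist3 z U) = twist3 z (ownShift θ U)` — the twisted seam `(U_n, g · tw_z U_0)` is again an ordinary bond;
* §2 ★ `seamDensity_le_exp_mul_ownShift_z`: the cost bound of `OwnAxis.seamDensity_le_exp_mul_ownShift` for every `z` with `z 0 = false`;
* §3 the good-field dictionary and the non-centrality floor ∕ shell membership on `goodEvent n z s t` for every `z` (the seam clause now reads against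
  `g · tw_z U_0`; the propagation uses interior bonds only).

HONEST FRAMING: fixed-lattice bookkeeping; nothing about infinite volume, the continuum limit or the Clay gap.  No `sorry`, no new axiom, no new
definition.  References: [cite: tHooft1979]; [cite: Luscher1983, §2]; [cite: SeilerLNP1982, §3].
-/

set_option autoImplicit false

noncomputable section

open scoped Quaternion BigOperators
open NormedSpace Function
open Literature.MathematicalPhysics.QuantumLattice (su2Quat su2Quat_ne_zero norm_su2Quat)
open Literature.MathematicalPhysics.QuantumFieldTheory hiding su2Quat_mul SU2
open Literature.MathematicalPhysics.QuantumFieldTheory.Balaban1983to89.T4HaarSU2ExpChart (expPoint)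

namespace Summit.QuantumFields.YangMills.Theorems.FemtoTransferGap.OwnAxis

open ClassShift
open Summit.QuantumFields.YangMills.Theorems.FemtoTransferGap.TT (twist3 twist3_apply goodEvent mem_goodEvent_iff centreElem)

variable {L : ℕ}

/-! ## §1 Commutation with the centre twists of the `y`- and `z`-directions -/

/-- A composite twist with `z 0 = false` does not touch the `x`-links. [cite: tHooft1979] -/
theorem twist3_apply_dir_zero {z : Fin 3 → Bool} (hz : z 0 = false) (U : GaugeConfig 3 L SU2) (y : Site 3 L) :
    twist3 z U (y, 0) = U (y, 0) := by
  rw [twist3_apply]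
  simp [hz, centreElem]

/-- Hence the `x`-line holonomies are unchanged. [folklore] -/
theorem lineHolonomy_twist3_of_apply_zero {z : Fin 3 → Bool} (hz : z 0 = false) (U : GaugeConfig 3 L SU2) (n : ℕ) (y : Site 3 L) :
    lineHolonomy (twist3 z U) 0 n y = lineHolonomy U 0 n y :=
  WilsonLoopRP.lineHolonomy_congr 0 n y fun _ _ => twist3_apply_dir_zero hz U _

/-- The own-axis field is unchanged by such a twist. [folklore] -/
theorem ownAxisField_twist3 {z : Fin 3 → Bool} (hz : z 0 = false) (θ : ℝ) (U : GaugeConfig 3 L SU2) :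
    ownAxisField θ (twist3 z U) = ownAxisField θ U := by
  funext y
  rw [ownAxisField_apply, ownAxisField_apply, lineHolonomy_twist3_of_apply_zero hz]

/-- ★ **The own-axis shift commutes with the `y`-, `z`-twists**: `ownShift θ (tw_z U) = tw_z (ownShift θ U)` for `z 0 = false`. [cite: tHooft1979] -/
theorem ownShift_twist3_comm {z : Fin 3 → Bool} (hz : z 0 = false) (θ : ℝ) (U : GaugeConfig 3 L SU2) :
    ownShift θ (twist3 z U) = twist3 z (ownShift θ U) := by
  rw [ownShift_def, ownShift_def, ownAxisField_twist3 hz]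
  funext e
  rw [siteTwist_apply, twist3_apply, twist3_apply, siteTwist_apply]
  by_cases he : e.2 = 0 ∧ e.1 0 = 0
  · rw [if_pos he, if_pos he]
    have h1 : (if e.1 e.2 = 0 then centreElem (z e.2) else 1) = (1 : SU2) := by
      rw [he.1, if_pos he.2]; simp [hz, centreElem]
    rw [h1, one_mul, one_mul]
  · rw [if_neg he, if_neg he]

/-! ## §2 The cost through a `y`/`z`-twisted seam -/

section CostZ

variable [NeZero L]

/-- ★ **The cost of the own-axis shift of every slice through a seam `(U_n, g · tw_z U_0)` with `z 0 = false`** — the bound of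
`OwnAxis.seamDensity_le_exp_mul_ownShift`, verbatim. [cite: Luscher1983, §2] [cite: SeilerLNP1982, §3] -/
theorem seamDensity_le_exp_mul_ownShift_z {z : Fin 3 → Bool} (hz : z 0 = false) {β : ℝ} (hβ : 0 ≤ β) (θ : ℝ) {σ ε τ : ℝ} (hσ : 0 < σ) {n : ℕ}
    (Us : Fin (n + 1) → GaugeConfig 3 L SU2) (g : Site 3 L → SU2)
    (hNC : ∀ (t : Fin (n + 1)) (y : Site 3 L), y 0 = 0 → σ ≤ ‖imVec (su2Quat (lineHolonomy (Us t) 0 L y))‖)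
    (hP : ∀ (t : Fin (n + 1)) (y : Site 3 L) (i j : Fin 3), ‖su2Quat (plaquetteHolonomy (Us t) y i j) - 1‖ ≤ ε)
    (hTi : ∀ (i : Fin n) (e : Edge 3 L), ‖su2Quat (Us i.castSucc e) - su2Quat (Us i.succ e)‖ ≤ τ)
    (hTs : ∀ e : Edge 3 L, ‖su2Quat (Us (Fin.last n) e) - su2Quat (gaugeTransform g (twist3 z (Us 0)) e)‖ ≤ τ) :
    (∏ i : Fin n, transferKernel su2Rep β (Us i.castSucc) (Us i.succ)) *
        transferKernel su2Rep β (Us (Fin.last n)) (gaugeTransform g (twist3 z (Us 0))) ≤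
      Real.exp (β * ((n + 1 : ℕ) * (Fintype.card (Plaquette 3 L) * ((|θ| * (2 * (L * ε) / σ)) ^ 2 + 2 * (|θ| * (2 * (L * ε) / σ)) * ε) +
          Fintype.card (Edge 3 L) * ((|θ| * (2 * (L * τ) / σ)) ^ 2 + 2 * (|θ| * (2 * (L * τ) / σ)) * τ)))) *
        ((∏ i : Fin n, transferKernel su2Rep β (ownShift θ (Us i.castSucc)) (ownShift θ (Us i.succ))) *
          transferKernel su2Rep β (ownShift θ (Us (Fin.last n))) (gaugeTransform g (twist3 z (ownShift θ (Us 0))))) := by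
  set bP : ℝ := (|θ| * (2 * (L * ε) / σ)) ^ 2 + 2 * (|θ| * (2 * (L * ε) / σ)) * ε with hbP
  set bT : ℝ := (|θ| * (2 * (L * τ) / σ)) ^ 2 + 2 * (|θ| * (2 * (L * τ) / σ)) * τ with hbT
  have h := TT.seamDensity_le_exp_mul (L := L) β z Us (fun t => ownShift θ (Us t)) g
    (Q := β * ((n + 1 : ℕ) * (Fintype.card (Plaquette 3 L) * bP + Fintype.card (Edge 3 L) * bT))) ?_
  · simpa only using h
  -- the seam slot `V := g · tw_z U_0`: its shift is the shift of the seam slot of the shifted ring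
  set V : GaugeConfig 3 L SU2 := gaugeTransform g (twist3 z (Us 0)) with hV
  have hVshift : gaugeTransform g (twist3 z (ownShift θ (Us 0))) = ownShift θ V := by
    rw [hV, ownShift_gaugeTransform, ownShift_twist3_comm hz]
  have hNCV : ∀ y : Site 3 L, y 0 = 0 → σ ≤ ‖imVec (su2Quat (lineHolonomy V 0 L y))‖ := fun y hy => by
    rw [hV, norm_imVec_lineHolonomy_gaugeTransform, lineHolonomy_twist3_of_apply_zero hz]
    exact hNC 0 y hy
  rw [hVshift]
  have hS : ∀ t : Fin (n + 1), wilsonAction su2Rep (ownShift θ (Us t)) - wilsonAction su2Rep (Us t) ≤ Fintype.card (Plaquette 3 L) * bP :=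
    fun t => wilsonAction_ownShift_sub_le θ hσ (Us t) (hNC t) (hP t)
  have hTint : ∀ i : Fin n, timeCoupling su2Rep (Us i.castSucc) (Us i.succ) - Fintype.card (Edge 3 L) * bT ≤
      timeCoupling su2Rep (ownShift θ (Us i.castSucc)) (ownShift θ (Us i.succ)) :=
    fun i => timeCoupling_ownShift_ge θ hσ _ _ (hNC _) (hNC _) (hTi i)
  have hTseam : timeCoupling su2Rep (Us (Fin.last n)) V - Fintype.card (Edge 3 L) * bT ≤
      timeCoupling su2Rep (ownShift θ (Us (Fin.last n))) (ownShift θ V) :=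
    timeCoupling_ownShift_ge θ hσ _ _ (hNC _) hNCV hTs
  have hsumS : ∑ t : Fin (n + 1), wilsonAction su2Rep (ownShift θ (Us t)) - ∑ t : Fin (n + 1), wilsonAction su2Rep (Us t) ≤
      (n + 1 : ℕ) * (Fintype.card (Plaquette 3 L) * bP) := by
    rw [← Finset.sum_sub_distrib]
    exact (Finset.sum_le_card_nsmul _ _ (Fintype.card (Plaquette 3 L) * bP) fun t _ => hS t).trans (by simp)
  have hsumT : ∑ i : Fin n, timeCoupling su2Rep (Us i.castSucc) (Us i.succ) - ∑ i : Fin n, timeCoupling su2Rep (ownShift θ (Us i.castSucc)) (ownShift θ (Us i.succ)) ≤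
      (n : ℕ) * (Fintype.card (Edge 3 L) * bT) := by
    rw [← Finset.sum_sub_distrib]
    exact (Finset.sum_le_card_nsmul _ _ (Fintype.card (Edge 3 L) * bT) fun i _ => by have := hTint i; linarith).trans (by simp)
  have hτ : 0 ≤ τ := (norm_nonneg _).trans (hTs ((0 : Site 3 L), 0))
  have hbT0 : 0 ≤ Fintype.card (Edge 3 L) * bT := by positivity
  have hkey : (∑ i : Fin n, timeCoupling su2Rep (Us i.castSucc) (Us i.succ)) + timeCoupling su2Rep (Us (Fin.last n)) V
        - ∑ t : Fin (n + 1), wilsonAction su2Rep (Us t)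
      - ((∑ i : Fin n, timeCoupling su2Rep (ownShift θ (Us i.castSucc)) (ownShift θ (Us i.succ))) +
          timeCoupling su2Rep (ownShift θ (Us (Fin.last n))) (ownShift θ V)
        - ∑ t : Fin (n + 1), wilsonAction su2Rep (ownShift θ (Us t))) ≤
      (n + 1 : ℕ) * (Fintype.card (Plaquette 3 L) * bP) + ((n : ℕ) * (Fintype.card (Edge 3 L) * bT) + Fintype.card (Edge 3 L) * bT) := by
    linarith [hsumS, hsumT, hTseam]
  have hring : ((n + 1 : ℕ) : ℝ) * (Fintype.card (Plaquette 3 L) * bP) + ((n : ℕ) * (Fintype.card (Edge 3 L) * bT) + Fintype.card (Edge 3 L) * bT) =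
      (n + 1 : ℕ) * (Fintype.card (Plaquette 3 L) * bP + Fintype.card (Edge 3 L) * bT) := by push_cast; ring
  rw [hring] at hkey
  have hwS : wilsonAction su2Rep V = wilsonAction su2Rep (Us 0) := by rw [hV]; exact TT.wilsonAction_act g z (Us 0)
  calc β * ((∑ i : Fin n, timeCoupling su2Rep (Us i.castSucc) (Us i.succ)) + timeCoupling su2Rep (Us (Fin.last n)) V) -
          β * ∑ t : Fin (n + 1), wilsonAction su2Rep (Us t) -
        (β * ((∑ i : Fin n, timeCoupling su2Rep (ownShift θ (Us i.castSucc)) (ownShift θ (Us i.succ))) +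
            timeCoupling su2Rep (ownShift θ (Us (Fin.last n))) (ownShift θ V)) -
          β * ∑ t : Fin (n + 1), wilsonAction su2Rep (ownShift θ (Us t)))
      = β * ((∑ i : Fin n, timeCoupling su2Rep (Us i.castSucc) (Us i.succ)) + timeCoupling su2Rep (Us (Fin.last n)) V
        - ∑ t : Fin (n + 1), wilsonAction su2Rep (Us t)
      - ((∑ i : Fin n, timeCoupling su2Rep (ownShift θ (Us i.castSucc)) (ownShift θ (Us i.succ))) +
          timeCoupling su2Rep (ownShift θ (Us (Fin.last n))) (ownShift θ V)
        - ∑ t : Fin (n + 1), wilsonAction su2Rep (ownShift θ (Us t)))) := by ring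
    _ ≤ β * ((n + 1 : ℕ) * (Fintype.card (Plaquette 3 L) * bP + Fintype.card (Edge 3 L) * bT)) := mul_le_mul_of_nonneg_left hkey hβ

end CostZ

/-! ## §3 The good-field dictionary, floors and shells in every sector -/

section GoodZ

variable [NeZero L]

/-- **The good-field event of the sector `z` in quaternion currency** (the seam clause against `g · tw_z U_0`). [cite: Luscher1983, §2] -/
theorem goodEvent_dictionary_z {n : ℕ} (z : Fin 3 → Bool) {s t : ℝ} {p : (Site 3 L → SU2) × (Fin (n + 1) → GaugeConfig 3 L SU2)}
    (hp : p ∈ goodEvent (L := L) n z s t) :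
    (∀ (k : Fin (n + 1)) (y : Site 3 L) (i j : Fin 3), ‖su2Quat (plaquetteHolonomy (p.2 k) y i j) - 1‖ ≤ Real.sqrt s) ∧
    (∀ (i : Fin n) (e : Edge 3 L), ‖su2Quat (p.2 i.castSucc e) - su2Quat (p.2 i.succ e)‖ ≤ t) ∧
    (∀ e : Edge 3 L, ‖su2Quat (p.2 (Fin.last n) e) - su2Quat (gaugeTransform p.1 (twist3 z (p.2 0)) e)‖ ≤ t) := by
  obtain ⟨hA, hB, hC⟩ := (mem_goodEvent_iff n z s t p).1 hp
  exact ⟨fun k y i j => norm_su2Quat_plaquette_sub_one_le (hA k).le y i j,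
    fun i e => (norm_su2Quat_sub_le_frobNorm _ _).trans (hB i e), fun e => (norm_su2Quat_sub_le_frobNorm _ _).trans (hC e)⟩

/-- ★ **The non-centrality floor on the good-field event of every sector**: `‖Im q(P_x(U_k))‖ ≥ polDist(U_0)/2 − 2L²√s − nLt`. [cite: Luscher1983, §2] -/
theorem norm_imVec_lineHolonomy_ge_of_goodEvent_z {n : ℕ} (z : Fin 3 → Bool) {s t : ℝ} {p : (Site 3 L → SU2) × (Fin (n + 1) → GaugeConfig 3 L SU2)}
    (hp : p ∈ goodEvent (L := L) n z s t) (k : Fin (n + 1)) {x : Site 3 L} (hx : x 0 = 0) :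
    FlatSheet.polDist (p.2 0) / 2 - 2 * (L * (L * Real.sqrt s)) - n * (L * t) ≤ ‖imVec (su2Quat (lineHolonomy (p.2 k) 0 L x))‖ := by
  obtain ⟨hP, hTi, -⟩ := goodEvent_dictionary_z z hp
  have h0 : FlatSheet.polDist (p.2 0) / 2 ≤ ‖imVec (su2Quat (lineHolonomy (p.2 0) 0 L 0))‖ := by
    unfold FlatSheet.polDist
    rw [polyX_eq_lineHolonomy]
    exact half_vacDist_le_norm_imVec _
  have h1 := norm_imVec_lineHolonomy_plane_ge (hP 0) hx
  have h2 := abs_norm_imVec_slice_sub_le hTi x k.val k.isLt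
  have hk : ((k.val : ℕ) : ℝ) * (L * t) ≤ n * (L * t) := by
    rcases Nat.eq_zero_or_pos n with hn | hn
    · subst hn
      rw [show ((k.val : ℕ) : ℝ) = 0 by exact_mod_cast (show k.val = 0 by omega)]
      simp
    · have hτ : 0 ≤ t := (norm_nonneg _).trans (hTi ⟨0, hn⟩ ((0 : Site 3 L), 0))
      exact mul_le_mul_of_nonneg_right (by exact_mod_cast Nat.lt_succ_iff.1 k.isLt) (by positivity)
  have hk2 : (⟨k.val, k.isLt⟩ : Fin (n + 1)) = k := rfl
  rw [hk2] at h2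
  have := abs_le.1 h2
  linarith

/-- The floor in every sector. [folklore] -/
theorem floor_of_goodEvent_z {n : ℕ} (z : Fin 3 → Bool) {s t σ : ℝ} {p : (Site 3 L → SU2) × (Fin (n + 1) → GaugeConfig 3 L SU2)}
    (hp : p ∈ goodEvent (L := L) n z s t)
    (hσle : σ ≤ FlatSheet.polDist (p.2 0) / 2 - 2 * (L * (L * Real.sqrt s)) - n * (L * t)) (k : Fin (n + 1)) (x : Site 3 L) (hx : x 0 = 0) :
    σ ≤ ‖imVec (su2Quat (lineHolonomy (p.2 k) 0 L x))‖ :=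
  hσle.trans (norm_imVec_lineHolonomy_ge_of_goodEvent_z z hp k hx)

/-- The chart shell in every sector. [folklore] -/
theorem lineHolonomy_mem_shell_of_goodEvent_z {n : ℕ} (z : Fin 3 → Bool) {s t σ : ℝ} (hσ : 0 < σ) {p : (Site 3 L → SU2) × (Fin (n + 1) → GaugeConfig 3 L SU2)}
    (hp : p ∈ goodEvent (L := L) n z s t)
    (hσle : σ ≤ FlatSheet.polDist (p.2 0) / 2 - 2 * (L * (L * Real.sqrt s)) - n * (L * t)) (k : Fin (n + 1)) {x : Site 3 L} (hx : x 0 = 0) :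
    lineHolonomy (p.2 k) 0 L x ∈ expPoint '' {v : EuclideanSpace ℝ (Fin 3) | Real.arcsin σ ≤ ‖v‖ ∧ ‖v‖ ≤ Real.pi - Real.arcsin σ} :=
  mem_image_expPoint_shell_of_le_norm_imVec hσ (floor_of_goodEvent_z z hp hσle k x hx)

end GoodZ

end Summit.QuantumFields.YangMills.Theorems.FemtoTransferGap.OwnAxis

end
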